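import Summits.QuantumAdvantage.QuantumAdvantage.Theses.SymplecticPurity
import Literature.Computability.QuantumComplexity.StabilizerRank

/-!
# Crux `DeqThesis` (stmt-QuantumAdvantage-0242, `BQP ⊆ BPP`) — ideator 2, round 1
# Idea `local-flatness-lu-frames`: LOCAL (LU-dressed) flatness and the dressed free-frame road

Sketch file: definitions + the first checkable statements of the line. Nothing here is a route item.
`X = DeqThesis = FFThesis` is expected FALSE; the line is a ROAD `H_LFF → X` whose scientific yield is
the KILL `¬H_LFF` (new theorem-candidate `CubeLocallyFlat`) and the loophole statement
`LuScrambledStabilizerFlat` (Pauli-flat states that ARE free in an LU-dressed Clifford frame).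
-/

noncomputable section

namespace Summit.QuantumAdvantage.QuantumAdvantage.Cruxes.DeqThesis.LocalFlatnessLuFrames

open Matrix Finset
open Literature.Computability.QuantumComplexity Literature.Computability.Cryptography
open Summit.QuantumAdvantage.QuantumAdvantage.Theses.SymplecticPurity

/-! ### Flatness notions -/

/-- ε-flat Pauli spectrum — verbatim the hypothesis shape of `SymplecticPurityBound`. -/
def PauliFlat (N : ℕ) (ε : ℝ) (ψ : QReg N → ℂ) : Prop :=
  ∀ S : Fin N → Pauli, S ≠ (fun _ => Pauli.I) → ‖star ψ ⬝ᵥ (pauliString S).mulVec ψ‖ ≤ ε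

/-- **Local (LU-dressed) flatness**: flat against every LOCALLY ROTATED Pauli string
`⊗ᵢ uᵢ σ_{Sᵢ} uᵢ†` (`uᵢ ∈ U(2)` arbitrary, `S ≠ I`). Sites with `Sᵢ = I` carry exactly `I`, so no
identity component is smuggled in; equivalently `max_{A ≠ ∅, n̂ᵢ ∈ S²} |⟨ψ| ⊗_{i∈A} n̂ᵢ·σ⃗ |ψ⟩| ≤ ε`. -/
def LocallyFlat (N : ℕ) (ε : ℝ) (ψ : QReg N → ℂ) : Prop :=
  ∀ u : Fin N → Matrix Bool Bool ℂ, (∀ i, u i ∈ Matrix.unitaryGroup Bool ℂ) →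
    ∀ S : Fin N → Pauli, S ≠ (fun _ => Pauli.I) →
      ‖star ψ ⬝ᵥ (tensorAll (fun i => u i * (S i).mat * star (u i))).mulVec ψ‖ ≤ ε

/-- Local flatness refines Pauli flatness (`u = 1`). -/
theorem pauliFlat_of_locallyFlat {N : ℕ} {ε : ℝ} {ψ : QReg N → ℂ}
    (h : LocallyFlat N ε ψ) : PauliFlat N ε ψ := by
  intro S hS
  have h1 := h (fun _ => (1 : Matrix Bool Bool ℂ)) (fun _ => Submonoid.one_mem _) S hS
  simpa [pauliString_eq] using h1

/-- A semantic Clifford unitary (as in the route file, items 10729–10731). -/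
def IsCliffordUnitary (N : ℕ) (U : Matrix (QReg N) (QReg N) ℂ) : Prop :=
  U ∈ Matrix.unitaryGroup (QReg N) ℂ ∧
    ∀ S : Fin N → Pauli, ∃ S' : Fin N → Pauli, ∃ c : ℂ, ‖c‖ = 1 ∧
      U * pauliString S * star U = c • pauliString S'

/-- The 4-fold agreement sum `Tr ρ_{<k}²` of the route files. -/
def cutPurity {N : ℕ} (k : ℕ) (φ : QReg N → ℂ) : ℂ :=
  ∑ x₁ : QReg N, ∑ x₂ : QReg N, ∑ x₃ : QReg N, ∑ x₄ : QReg N,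
    (if (∀ i, k ≤ i.val → x₁ i = x₂ i) ∧ (∀ i, i.val < k → x₂ i = x₃ i) ∧
        (∀ i, k ≤ i.val → x₃ i = x₄ i) ∧ (∀ i, i.val < k → x₄ i = x₁ i) then
      φ x₁ * star (φ x₂) * φ x₃ * star (φ x₄) else 0)

/-! ### Algebra of local layers (proved here) -/

section tensorAlgebra
variable {ι : Type*} [Fintype ι] [DecidableEq ι]

/-- `tensorAll` is multiplicative. -/
theorem tensorAll_mul (A B : ι → Matrix Bool Bool ℂ) :
    tensorAll A * tensorAll B = tensorAll (fun i => A i * B i) := by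
  ext x y
  simp only [Matrix.mul_apply, tensorAll_apply]
  rw [Finset.prod_univ_sum]
  simp only [Fintype.piFinset_univ]
  refine Finset.sum_congr rfl fun z _ => ?_
  rw [Finset.prod_mul_distrib]

omit [DecidableEq ι] in
/-- `tensorAll` commutes with the conjugate transpose. -/
theorem conjTranspose_tensorAll (A : ι → Matrix Bool Bool ℂ) :
    (tensorAll A)ᴴ = tensorAll (fun i => (A i)ᴴ) := by
  ext x y
  simp only [Matrix.conjTranspose_apply, tensorAll_apply, star_prod]

/-- `⟨Mψ| P |Mψ⟩ = ⟨ψ| Mᴴ P M |ψ⟩`. -/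
theorem star_mulVec_dot (M P : Matrix (ι → Bool) (ι → Bool) ℂ) (ψ : (ι → Bool) → ℂ) :
    star (M *ᵥ ψ) ⬝ᵥ (P *ᵥ (M *ᵥ ψ)) = star ψ ⬝ᵥ ((Mᴴ * P * M) *ᵥ ψ) := by
  rw [Matrix.star_mulVec, ← Matrix.dotProduct_mulVec, Matrix.mulVec_mulVec, Matrix.mulVec_mulVec]

/-- `tensorAll 1 = 1`. -/
theorem tensorAll_one : tensorAll (fun _ : ι => (1 : Matrix Bool Bool ℂ)) = 1 := by
  ext x y
  simp only [tensorAll_apply, Matrix.one_apply]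
  by_cases h : x = y
  · subst h; simp
  · obtain ⟨i, hi⟩ := Function.ne_iff.mp h
    rw [if_neg h]
    exact Finset.prod_eq_zero (Finset.mem_univ i) (by simp [hi])

/-- A layer of single-qubit unitaries is unitary. -/
theorem tensorAll_unitary (u : ι → Matrix Bool Bool ℂ)
    (hu : ∀ i, u i ∈ Matrix.unitaryGroup Bool ℂ) : (tensorAll u)ᴴ * tensorAll u = 1 := by
  rw [conjTranspose_tensorAll, tensorAll_mul]
  have : (fun i => (u i)ᴴ * u i) = fun _ => (1 : Matrix Bool Bool ℂ) := by
    funext i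
    have h := hu i
    rw [Matrix.mem_unitaryGroup_iff'] at h
    simpa [Matrix.star_eq_conjTranspose] using h
  rw [this, tensorAll_one]

end tensorAlgebra

/-! ### First lemma of the kill side: an LU layer moves between the two notions -/

/-- `⟨(⊗u)ψ| σ_S |(⊗u)ψ⟩ = ⟨ψ| ⊗ᵢ uᵢ† σ_{Sᵢ} uᵢ |ψ⟩`: a local unitary layer turns local flatness into
Pauli flatness (elementary: `tensorAll` is multiplicative and `star`-compatible). -/
def LuReduction : Prop :=
  ∀ (N : ℕ) (ε : ℝ) (ψ : QReg N → ℂ), LocallyFlat N ε ψ →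
    ∀ u : Fin N → Matrix Bool Bool ℂ, (∀ i, u i ∈ Matrix.unitaryGroup Bool ℂ) →
      PauliFlat N ε ((tensorAll u).mulVec ψ)

/-- A local unitary layer preserves the norm. -/
def LocalUnitaryNormSq : Prop :=
  ∀ (N : ℕ) (u : Fin N → Matrix Bool Bool ℂ), (∀ i, u i ∈ Matrix.unitaryGroup Bool ℂ) →
    ∀ ψ : QReg N → ℂ, normSq ((tensorAll u).mulVec ψ) = normSq ψ

/-- **LuReduction holds** (proved). -/
theorem luReduction : LuReduction := by
  intro N ε ψ hloc u hu S hS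
  have key : star ((tensorAll u).mulVec ψ) ⬝ᵥ (pauliString S).mulVec ((tensorAll u).mulVec ψ) =
      star ψ ⬝ᵥ (tensorAll (fun i => star (u i) * (S i).mat * star (star (u i)))).mulVec ψ := by
    rw [star_mulVec_dot, pauliString_eq, conjTranspose_tensorAll, tensorAll_mul, tensorAll_mul]
    simp only [Matrix.star_eq_conjTranspose, Matrix.conjTranspose_conjTranspose]
  rw [key]
  exact hloc (fun i => star (u i)) (fun i => Unitary.star_mem (hu i)) S hS

/-- **LocalUnitaryNormSq holds** (proved). -/
theorem localUnitaryNormSq : LocalUnitaryNormSq := by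
  intro N u hu ψ
  have h2 : ∀ v : QReg N → ℂ, star v ⬝ᵥ v = ((normSq v : ℝ) : ℂ) := fun v => by
    simp only [dotProduct, Pi.star_apply, normSq]
    push_cast
    exact Finset.sum_congr rfl fun x _ => by rw [Complex.star_def, Complex.conj_mul']
  have h1 : star ((tensorAll u).mulVec ψ) ⬝ᵥ (tensorAll u).mulVec ψ = star ψ ⬝ᵥ ψ := by
    have h := star_mulVec_dot (tensorAll u) 1 ψ
    rw [Matrix.one_mulVec] at h
    rw [h, Matrix.mul_one, tensorAll_unitary u hu, Matrix.one_mulVec]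
  rw [h2, h2] at h1
  exact_mod_cast h1

/-- **Dressed-frame purity bound** (the kill currency): a LOCALLY flat unit vector keeps a linear
cut of purity `≤ 4ε` in every LU-DRESSED Clifford frame `U ∘ (⊗ᵢ uᵢ)` with any stabilizer ancillas. -/
def LuDressedFramePurityBound : Prop :=
  ∀ (n m : ℕ) (ε : ℝ) (ψ : QReg n → ℂ), 1 ≤ n → normSq ψ = 1 → LocallyFlat n ε ψ →
    ∀ u : Fin n → Matrix Bool Bool ℂ, (∀ i, u i ∈ Matrix.unitaryGroup Bool ℂ) →
      ∀ U : Matrix (QReg (n + m)) (QReg (n + m)) ℂ, IsCliffordUnitary (n + m) U →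
        ∃ k ≤ n + m, ‖cutPurity k (U.mulVec (tensorVec ((tensorAll u).mulVec ψ) (zeroState m)))‖
          ≤ 4 * ε

/-- Composition: the dressed bound is the route's `SymplecticPurityBound` applied to `(⊗u)ψ`. -/
theorem luDressedFramePurityBound_of (hR : LuReduction) (hN : LocalUnitaryNormSq)
    (hB : SymplecticPurityBound) : LuDressedFramePurityBound := by
  intro n m ε ψ hn hψ hloc u hu U hU
  have hflat : PauliFlat n ε ((tensorAll u).mulVec ψ) := hR n ε ψ hloc u hu
  have hnorm : normSq ((tensorAll u).mulVec ψ) = 1 := by rw [hN n u hu ψ, hψ]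
  obtain ⟨k, hk, h⟩ := hB n m ε ((tensorAll u).mulVec ψ) hn hnorm hflat U hU.1 hU.2
  exact ⟨k, hk, by simpa [cutPurity] using h⟩

/-- Hence the dressed bound needs ONLY the route's `SymplecticPurityBound` (10729). -/
theorem luDressedFramePurityBound_of_route (hB : SymplecticPurityBound) : LuDressedFramePurityBound :=
  luDressedFramePurityBound_of luReduction localUnitaryNormSq hB

/-! ### The witness: the normalised cube graph state of the route (`CubeGraphFlat`, 9836) -/

/-- The normalised data-loading state `2^{-n/2} Σ_x |x⟩|e((e⁻¹x)³)⟩` of `x ↦ x³` on a field of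
order `2ⁿ` (verbatim the vector of `CompositeFrameBound`, 10730). -/
def cubeState (n : ℕ) (K : Type) [Field K] (e : K ≃+ (Fin n → ZMod 2)) : QReg (n + n) → ℂ :=
  fun w => if (fun j : Fin n => w (Fin.natAdd n j)) =
      (fun j : Fin n => decide (e ((e.symm (fun i : Fin n => if w (Fin.castAdd n i) then 1 else 0)) ^ 3) j = 1))
    then ((Real.sqrt 2 ^ n)⁻¹ : ℂ) else 0

/-- **Kill conjecture (crux-grade, the load-bearing new statement)**: the cube state is LOCALLY flat
at an exponential rate — every product test `⊗ᵢ n̂ᵢ·σ⃗` (not only Pauli strings: differential AND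
linear cryptanalysis are the two Pauli slices) has exponentially small expectation. -/
def CubeLocallyFlat : Prop :=
  ∃ δ : ℝ, 0 < δ ∧ ∃ n₀ : ℕ, ∀ n ≥ n₀, ∀ (K : Type) [Field K] [Fintype K], Fintype.card K = 2 ^ n →
    ∀ e : K ≃+ (Fin n → ZMod 2), LocallyFlat (n + n) ((2 : ℝ) ^ (-(δ * (n : ℝ)))) (cubeState n K e)

/-- Strong form suggested by the random-state heuristic (to be calibrated by the kit job):
rate `2^{-n/2}` up to a polynomial, i.e. the Pauli rate of `CubeGraphFlat` survives dressing. -/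
def CubeLocallyFlatStrong : Prop :=
  ∃ C : ℝ, ∃ d : ℕ, ∀ n ≥ 1, ∀ (K : Type) [Field K] [Fintype K], Fintype.card K = 2 ^ n →
    ∀ e : K ≃+ (Fin n → ZMod 2),
      LocallyFlat (n + n) (C * (n : ℝ) ^ d * (Real.sqrt 2 ^ n)⁻¹) (cubeState n K e)

/-- Local flatness restricted to product tests of SUPPORT WEIGHT `≤ w`. -/
def LocallyFlatUpTo (N w : ℕ) (ε : ℝ) (ψ : QReg N → ℂ) : Prop :=
  ∀ u : Fin N → Matrix Bool Bool ℂ, (∀ i, u i ∈ Matrix.unitaryGroup Bool ℂ) →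
    ∀ S : Fin N → Pauli, S ≠ (fun _ => Pauli.I) →
      (Finset.univ.filter fun i => S i ≠ Pauli.I).card ≤ w →
        ‖star ψ ⬝ᵥ (tensorAll (fun i => u i * (S i).mat * star (u i))).mulVec ψ‖ ≤ ε

/-- **Light-support local flatness of the cube state — provable now** (elementary: expand each rotated
factor in `X, Y, Z`; the all-`Z` word is a Walsh coefficient `≤ 2√2ⁿ/2ⁿ` (9836/9841), every word with a
non-empty `X`-part on the input register has modulus `≤ 2/2ⁿ` by APN-ness of `x³` (≤ 2 solutions of
`(x+a)³ + x³ = b`), words with `X`-part only on the output register vanish, and the `ℓ¹` mass of the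
coefficients is `≤ 3^{w/2}`; for `w ≤ n/2`: `2^{1-n/2} + 2^{1-n}·3^{n/4} ≤ 4/√2ⁿ`). The genuinely new
content of `CubeLocallyFlat` is therefore the HEAVY supports `w > n/2`, where the `±2/2ⁿ` differential
words must cancel — numerically they do (kit j013529: full-support maximum ≈ Pauli maximum, n ≤ 7). -/
def CubeLightSupportFlat : Prop :=
  ∀ n ≥ 1, ∀ (K : Type) [Field K] [Fintype K], Fintype.card K = 2 ^ n →
    ∀ e : K ≃+ (Fin n → ZMod 2),
      LocallyFlatUpTo (n + n) (n / 2) (4 * (Real.sqrt 2 ^ n)⁻¹) (cubeState n K e)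

/-! ### The road to X and its negation -/

/-- **H_LFF** (representational, weakest form, as `NoFreeFrame`'s antecedent but DRESSED): every
uniform oracle-free Clifford+T family has, at every input and stage, an LU-dressed Clifford frame
`U ∘ (⊗ᵢ uᵢ)` in which every linear cut has purity `≥ 1/poly` — the representability beneath
Clifford-augmented MPS simulators that also optimise a layer of single-qubit bases. -/
def LuDressedFreeFrames : Prop :=
  ∀ F : QCircuitFamily cliffordT, F.IsOracleFree → F.IsUniform → ∃ c : ℕ, ∀ x : List Bool, ∀ j : ℕ,
    ∃ u : Fin (x.length + F.ancillas x.length) → Matrix Bool Bool ℂ,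
      (∀ i, u i ∈ Matrix.unitaryGroup Bool ℂ) ∧
      ∃ U : Matrix (QReg (x.length + F.ancillas x.length)) (QReg (x.length + F.ancillas x.length)) ℂ,
        IsCliffordUnitary _ U ∧
        ∀ k ≤ x.length + F.ancillas x.length,
          (1 : ℝ) / (x.length ^ c + c) ≤ ‖cutPurity k (U.mulVec ((tensorAll u).mulVec (F.stateAfter x j)))‖

/-- The kill target of the line: `¬H_LFF` (from `CubeLocallyFlat` + `LuDressedFramePurityBound` + the
route's uniform cube family, exactly as `NoFreeFrame` follows from `CubeGraphFlat`). -/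
def NoLuDressedFreeFrame : Prop := ¬ LuDressedFreeFrames

/-- **The loophole statement** (why dressing matters; numerically probed by the kit job): there are
PAULI-flat unit vectors that are FREE (bond dimension 1) in an LU-dressed stabilizer frame —
`(⊗ᵢ uᵢ) φ` with `φ` a stabilizer state. If true, `SymplecticPurityBound` alone cannot exclude
dressed free frames, and `CubeLocallyFlat` is genuinely new content, not a corollary of 9836. -/
def LuScrambledStabilizerFlat : Prop :=
  ∃ c : ℝ, c < 1 ∧ ∃ N₀ : ℕ, ∀ N ≥ N₀, ∃ φ ∈ stabilizerStates N,
    ∃ u : Fin N → Matrix Bool Bool ℂ, (∀ i, u i ∈ Matrix.unitaryGroup Bool ℂ) ∧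
      normSq φ = 1 ∧ PauliFlat N (c ^ N) ((tensorAll u).mulVec φ)

/-- The crux decl this line answers to (rank-0 thesis X, shared by 8 routes): -/
example : FFThesis = (Literature.Computability.Cryptography.BQP ⊆ Literature.Computability.Complexity.BPP) := rfl

end Summit.QuantumAdvantage.QuantumAdvantage.Cruxes.DeqThesis.LocalFlatnessLuFrames
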